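import Summits.BirchSwinnertonDyer.BirchSwinnertonDyer.Theorems.Rank1ResidualX9Defs
import Literature.NumberTheory.EllipticCurves.HeegnerModuleIndex
import Literature.NumberTheory.EllipticCurves.BurungaleCastellaKim2021.HowardTheoremBIrreducible
import HarnessLib

/-!
# Class X9 (irreducible, NON-surjective image at a good ordinary `p ≥ 5`): Kolyvagin systems
# without surjectivity — the two repaired hypotheses, TYPED (cell `bsd-smallim`, seat `koly`)

HONEST FRAMING (cell `bsd-smallim`, FULL-BSD rank-`≤ 1` programme tranche 1b): provers of the cell
write PROOFS from published inputs and have them refereed inside the cell; a PASSed memo is a CELL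
THEOREM, not a Literature fact and not a kernel proof. The memo of this seat is
`run/shared/lean/pub/bsd-smallim/koly/KOLY-MEMO.md` (v1, 2026-08-25; referee verdict PENDING at the
time of filing). The typed TARGET of the class is unchanged and NOT proved:
`IntegralMainConjectureOnClassX9` / `BSDpOnClassX9` of `Rank1ResidualX9Defs` (X9 gens 1–2). Nothing
below asserts anything about any curve: two `Prop`-valued names (`@[conjecture]`, i.e. OPEN obligation
nodes provable / refutable by name) and kernel-checked bookkeeping between them and the tree's
vocabulary.

WHAT THE MEMO PROVES (paper proofs, to be refereed) and this file NAMES: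

* `X9TwistedHypothesisIm` (memo Thm. 3.1, "eigenvalue compensation by a tame twist"): at every X9
  pair there is a root of unity `ζ ∈ ℤ_p`, `ζ² ≠ 1`, and `σ ∈ G_{ℚ(μ_{p^∞})}` with
  `T_pE/(ζ·ρ(σ) - 1)T_pE ≅ ℤ_p` — i.e. hypothesis (im) of Burungale–Castella–Skinner 2025 (= Kato
  2004 Thm. 13.4 (3)'s hypothesis = Skinner 2016 §2.5 (b)) HOLDS for the twisted lattice
  `T_pE ⊗ χ` at an element with `χ(σ) = ζ` (whence Kato's INTEGRAL Thm. 17.4 (3) for the newform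
  `f_E ⊗ χ`, `χ` of prime conductor `q ∤ Np` and order `ord ζ`), although (im) FAILS for `T_pE` itself
  on X9 (`not_bcsHypothesisIm_of_classX9`, X9 gen 1; here `not_twistedHypothesisIm_one_of_classX9`).
  The predicate `TwistedHypothesisIm W p ζ` is (im) with `ρ(σ)` replaced by `ζ • ρ(σ)`; at `ζ = 1`
  it is literally `BCSHypothesisIm` (`twistedHypothesisIm_one_iff`).
* `Howard2004_thmB_of_irreducible` (memo Thm. 4.1 (B), the announced-but-unposted "[BS24] shape"
  written by the cell): Howard, Compositio 140 (2004), Thm. B — the tree's named fact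
  `Howard2004_thmB`, recorded under `HowardHypotheses` whose field `surjective` reads "`Γ_K →
  Aut_{ℤ_p}(T_pE)` is surjective" — with that field REPLACED by "`E[p]` is an irreducible
  `𝔽_p[G_ℚ]`-module and `p ≥ 5`" (`HowardHypothesesIrr`), conclusion verbatim. Memo proof: Howard's
  theory is axiomatised by his H.0–H.5 (§2.3) and surjectivity is used only to verify H.1, H.2 and
  `E(K[n])[p] = E(K_∞)[p] = 0` (arXiv:1202.6340 pp. 12, 13, 15–16); at an odd irreducible image these
  follow from ONE lemma — the image contains a non-trivial scalar whose Teichmüller lift kills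
  `H¹(K(E[p^∞])/K, E[p])` (Sah) — so H.0–H.5 hold under (irr_ℚ) for `p ≥ 5`. On an X9 pair with
  admissible `(K, κ, γ)` the new hypotheses hold (`HowardHypothesesIrr.of_classX9`), while Howard's
  printed ones do not (the image is not even surjective mod `p`).

Consumer / sanity edges (kernel): `Howard2004_thmB_of_howard2004_thmB_of_irreducible` (the new name
implies the printed fact on the locus `p ≥ 5 ∧ (irr)`), `howardThmBConclusion_of_classX9` (the new
name delivers Howard's conclusion at every X9 pair), `exists_twistedHypothesisIm_ne_one_of_X9Twisted`.

WHAT THIS IS NOT: not a proof of either name in the kernel; not `IntegralMainConjectureOnClassX9`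
(memo Prop. 2.6 / Prop. 5.1 explain why neither repair reaches it); no label, count or tier moves.

References: B. Howard, Compositio Math. 140 (2004) 1439–1472, Thms. A, B, §2.3, Lemma 2.6.2, §3.1
[Howard2004HeegnerKolyvagin]; A. Burungale, F. Castella, C. Skinner, IMRN 2025 = arXiv:2405.00270v2,
(im) p. 2, (sur) p. 3, Rem. 1.2.3, Thm. 4.2.1 [BurungaleCastellaSkinner2025]; K. Kato, Astérisque 295
(2004) Thm. 13.4 (3), 17.4 (3) [Kato2004Asterisque]; C. Skinner, Pacific J. Math. 283 (2016) §2.5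
[Skinner2016PacificMC]; F. Castella, G. Grossi, J. Lee, C. Skinner, Invent. Math. 227 (2022) §3.3
(error terms `C₁, C₂`) [CastellaGrossiLeeSkinner2022].
-/

-- the summit and its single problem are both named `BirchSwinnertonDyer` (registry layout D-0017)
set_option linter.dupNamespace false

noncomputable section

open scoped Classical

open WeierstrassCurve Field
open Literature.NumberTheory.EllipticCurves

universe u

namespace Summit.BirchSwinnertonDyer.BirchSwinnertonDyer.Rank1Residual

/-! ### 1. Hypothesis (im) for a tame twist of the Tate module -/

/-- **Hypothesis (im) for the twisted lattice `T_pE ⊗ χ`, at an element `σ` with `χ(σ) = ζ`.**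
Burungale–Castella–Skinner 2025, p. 2, hypothesis (im): "there exists an element
`σ ∈ G_{ℚ(μ_{p^∞})}` such that `T/(σ - 1)T ≃ ℤ_p`" (= Kato 2004 Thm. 13.4 (3): "`Coker(1 - σ : T → T)`
is a free `O_L`-module of rank 1"), transcribed exactly as `BCSHypothesisIm` of
`Rank1ResidualX9Defs` but with `ρ_{E,p}(σ)` replaced by `ζ · ρ_{E,p}(σ)` for a fixed `ζ ∈ ℤ_p`:
`σ ∈ Γ_ℚ` fixes every `p`-power root of unity and `T_pE / (ζ·ρ(σ) - 1)T_pE ≅ ℤ_p`. For a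
Dirichlet character `χ` with values in `ℤ_p^×` and `χ(σ) = ζ`, `ζ·ρ(σ)` is the action of `σ` on
`T_pE ⊗ ℤ_p(χ)`, so this is (im) for that lattice at `σ`. A PREDICATE on `(E, p, ζ)`; nothing
asserted. [cite: BurungaleCastellaSkinner2025, hypothesis (im) (p. 2) (shape only; nothing asserted)]
[cite: Kato2004Asterisque, Thm. 13.4 (3) (shape only; nothing asserted)] -/
def TwistedHypothesisIm (W : WeierstrassCurve ℚ) (p : ℕ) [Fact p.Prime] (ζ : ℤ_[p]) : Prop :=
  ∃ σ : absoluteGaloisGroup ℚ,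
    (∀ (n : ℕ) (t : AlgebraicClosure ℚ), t ^ p ^ n = 1 → σ • t = t) ∧
      Nonempty
        (((W.tateModule p) ⧸ LinearMap.range (ζ • W.galoisRepTate p σ - 1)) ≃ₗ[ℤ_[p]] ℤ_[p])

/-- At `ζ = 1` the twisted hypothesis is literally (im) = `BCSHypothesisIm`. [folklore] -/
theorem twistedHypothesisIm_one_iff (W : WeierstrassCurve ℚ) (p : ℕ) [Fact p.Prime] :
    TwistedHypothesisIm W p 1 ↔ BCSHypothesisIm W p := by
  constructor
  · rintro ⟨σ, hσ, ⟨e⟩⟩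
    rw [one_smul] at e
    exact ⟨σ, hσ, ⟨e⟩⟩
  · rintro ⟨σ, hσ, ⟨e⟩⟩
    refine ⟨σ, hσ, ⟨?_⟩⟩
    rw [one_smul]
    exact e

/-- **On class X9 the untwisted hypothesis fails** (`ζ = 1`): restatement of
`not_bcsHypothesisIm_of_classX9` (X9 gen 1: an element with `T/(σ-1)T ≅ ℤ_p` is a transvection
mod `p`, impossible when `p ∤ #ρ̄(Γ_ℚ)`). [folklore] -/
theorem not_twistedHypothesisIm_one_of_classX9 (W : WeierstrassCurve ℚ) [W.IsElliptic]
    [W.IsGloballyMinimal] (p : ℕ) [Fact p.Prime] (hX9 : ClassX9 W p) :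
    ¬ TwistedHypothesisIm W p 1 := fun h =>
  not_bcsHypothesisIm_of_classX9 W p hX9 ((twistedHypothesisIm_one_iff W p).mp h)

/-- **TYPED CELL STATEMENT (memo `KOLY-MEMO.md` Thm. 3.1 restricted to X9; referee pending; OPEN
obligation node, nothing asserted).** For every X9 pair `(E, p)` there is `ζ ∈ ℤ_p` with
`ζ^{p-1} = 1`, `ζ² ≠ 1` (a root of unity of order `d ≥ 3`, `d ∣ p - 1`: `d = 4` for the images 5Ns
and 5S4, `d ∈ {3, 6}` for 7Ns) such that the twisted hypothesis (im) holds at `ζ`. Memo proof: `Ḡ ∩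
SL₂(𝔽_p) ⊄ {±1}` contains a semisimple `h` with eigenvalues `ζ̄^{±1}`, `ζ̄² ≠ 1`; its multiplicative
Jordan (Teichmüller) lift `s` lies in the closed group `ρ(Γ_ℚ) ∩ SL₂(ℤ_p) = ρ(G_{ℚ(μ_{p^∞})})` and is
diagonalisable over `ℤ_p` with eigenvalues `ζ^{±1}`; for `σ` with `ρ(σ) = s`, `ζ⁻¹·ρ(σ) - 1 =
diag(0, ζ⁻² - 1)` has cokernel `ℤ_p` since `ζ⁻² - 1 ∈ ℤ_p^×` (the statement is recorded with `ζ⁻¹`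
renamed `ζ`). Consequence in print's currency: Kato Thm. 13.4 (3) applies to Kato's Euler system of
the newform `f_E ⊗ χ` for a character `χ` of prime conductor `q ∤ Np` and order `ord ζ` (Skinner
2016 §2.5: hypotheses (a) irreducible + (b) such a `σ` suffice for Kato's integral divisibility),
although it does not apply to `f_E` (`not_twistedHypothesisIm_one_of_classX9`).
[cite: Skinner2016PacificMC, §2.5 (a), (b)] [cite: Kato2004Asterisque, Thm. 13.4 (3) and Thm. 17.4 (3)] -/
@[conjecture] def X9TwistedHypothesisIm : Prop :=
  ∀ (W : WeierstrassCurve ℚ) [W.IsElliptic] [W.IsGloballyMinimal] (p : ℕ) [Fact p.Prime],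
    ClassX9 W p → ∃ ζ : ℤ_[p], ζ ^ (p - 1) = 1 ∧ ζ ^ 2 ≠ 1 ∧ TwistedHypothesisIm W p ζ

/-- **Consumer edge**: the cell statement supplies, at every X9 pair, a GENUINELY twisted instance of
(im) (`ζ ≠ 1`), to be contrasted with the failure at `ζ = 1`. [folklore] -/
theorem exists_twistedHypothesisIm_ne_one_of_X9Twisted (h : X9TwistedHypothesisIm)
    (W : WeierstrassCurve ℚ) [W.IsElliptic] [W.IsGloballyMinimal] (p : ℕ) [Fact p.Prime]
    (hX9 : ClassX9 W p) : ∃ ζ : ℤ_[p], ζ ≠ 1 ∧ TwistedHypothesisIm W p ζ := by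
  obtain ⟨ζ, -, h2, h3⟩ := h W p hX9
  exact ⟨ζ, fun h1 => h2 (by rw [h1, one_pow]), h3⟩

/-! ### 2. Howard 2004, Theorem B, with surjectivity replaced by irreducibility -/

section Howard

variable (N : ℕ) [NeZero N] (W : WeierstrassCurve ℚ) [W.IsGloballyMinimal]
  (K : Type u) [Field K] [NumberField K] (p : ℕ) [Fact p.Prime] (κ : ZpExtension K p)
  (γ : absoluteGaloisGroup K) (jbar : AlgebraicClosure K →+* ℂ)

/-- **Howard's standing hypotheses with "`Γ_K → Aut_{ℤ_p}(T_pE)` surjective" REPLACED by "`E[p]` is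
an irreducible `𝔽_p[Γ_ℚ]`-module and `p ≥ 5`"** — every other field verbatim as in the tree's
`HowardHypotheses` (Howard 2004 Thms. A, B, §3: `K` imaginary quadratic, `d_K ∉ {-3,-4}`, Heegner
hypothesis for `N`, `p ∤ N`, `p ∤ d_K`, `p ∤ h_K`, `E` good ordinary at `p`, `κ` anticyclotomic with
topological generator `γ`; `p ≥ 5` replaces "`p` odd"). The memo (Thm. 4.1) proves that these imply
Howard's axioms H.0–H.5 for `(T_pE, 𝓕, 𝒫)` and for every height-one specialisation `T_𝔭`, which is
all his proofs use. A PREDICATE (a `structure … : Prop`); nothing asserted.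
[cite: Howard2004HeegnerKolyvagin, §1 Thm. A, Thm. B, §2.3 (H.0–H.5) and §3 (shape only; nothing asserted)] -/
structure HowardHypothesesIrr : Prop where
  /-- `K` is imaginary quadratic. -/
  isImaginaryQuadratic : IsImaginaryQuadratic K
  /-- `d_K ≠ -3, -4`. -/
  discr_ne : NumberField.discr K ≠ -3 ∧ NumberField.discr K ≠ -4
  /-- Every prime dividing `N` splits in `K`. -/
  heegner : SatisfiesHeegnerHypothesis N K
  /-- `p ≥ 5`. -/
  five_le : 5 ≤ p
  /-- `p ∤ N`. -/
  not_dvd_level : ¬ p ∣ N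
  /-- `p ∤ d_K`. -/
  not_dvd_discr : ¬ (p : ℤ) ∣ NumberField.discr K
  /-- `p ∤ h_K`. -/
  not_dvd_classNumber : ¬ p ∣ NumberField.classNumber K
  /-- `E[p]` is an irreducible `𝔽_p[Γ_ℚ]`-module (REPLACES Howard's surjectivity). -/
  irreducible : W.HasIrreducibleModPGaloisRep p
  /-- `E` has good ordinary reduction at `p`. -/
  ordinary : IsOrdinaryAt W p
  /-- `κ` is the anticyclotomic `ℤ_p`-extension of `K`. -/
  anticyclotomic : κ.IsAnticyclotomic
  /-- `γ` is a topological generator of `Gal(K_∞/K)`. -/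
  topGenerator : κ.IsTopGenerator γ

variable {N W K p κ γ} in
omit [NeZero N] in
/-- Howard's printed hypotheses together with (irr) and `p ≥ 5` give the new hypotheses (the new
package asks for LESS than "Howard + irr": it drops surjectivity). [folklore] -/
theorem HowardHypothesesIrr.of_howardHypotheses (h : HowardHypotheses N W K p κ γ) (h5 : 5 ≤ p)
    (hirr : W.HasIrreducibleModPGaloisRep p) : HowardHypothesesIrr N W K p κ γ where
  isImaginaryQuadratic := h.isImaginaryQuadratic
  discr_ne := h.discr_ne
  heegner := h.heegner
  five_le := h5
  not_dvd_level := h.not_dvd_level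
  not_dvd_discr := h.not_dvd_discr
  not_dvd_classNumber := h.not_dvd_classNumber
  irreducible := hirr
  ordinary := h.ordinary
  anticyclotomic := h.anticyclotomic
  topGenerator := h.topGenerator

variable {N W K p κ γ} in
omit [NeZero N] in
/-- **On an X9 pair the new hypotheses hold** for every admissible anticyclotomic datum
`(K, κ, γ)` (imaginary quadratic, `d_K ∉ {-3,-4}`, Heegner for `N`, `p ∤ N d_K h_K`): `ClassX9` supplies
`p ≥ 5`, good ordinary reduction and irreducibility. (Howard's own `HowardHypotheses` cannot hold
there: the image is not even surjective mod `p`.) [folklore] -/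
theorem HowardHypothesesIrr.of_classX9 [W.IsElliptic] (hX9 : ClassX9 W p)
    (hK : IsImaginaryQuadratic K)
    (hd : NumberField.discr K ≠ -3 ∧ NumberField.discr K ≠ -4) (hH : SatisfiesHeegnerHypothesis N K)
    (hN : ¬ p ∣ N) (hD : ¬ (p : ℤ) ∣ NumberField.discr K) (hh : ¬ p ∣ NumberField.classNumber K)
    (hκ : κ.IsAnticyclotomic) (hγ : κ.IsTopGenerator γ) : HowardHypothesesIrr N W K p κ γ where
  isImaginaryQuadratic := hK
  discr_ne := hd
  heegner := hH
  five_le := hX9.2.1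
  not_dvd_level := hN
  not_dvd_discr := hD
  not_dvd_classNumber := hh
  irreducible := hX9.2.2.2.2.1
  ordinary := (isOrdinaryAt_iff W p).mpr ⟨hX9.2.2.1, hX9.2.2.2.1⟩
  anticyclotomic := hκ
  topGenerator := hγ

variable {N W K κ γ jbar} in
/-- **The conclusion of Howard's Theorem B**, verbatim as recorded in the tree's named fact
`Howard2004_thmB` (rank one and torsion-freeness of `𝔖 = lim← S_p(E/K_n)`, rank one of `X`, and
`char(X_{Λ-tors}) ∣ I(ℋ_∞)²`), isolated as a predicate on the data `(D, F, X)` so that the printed fact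
and the cell statement below visibly share it (`howard2004_thmB_iff`). [cite: Howard2004HeegnerKolyvagin, §1 Thm. B (shape only; nothing asserted)] -/
def HowardThmBConclusion (D : (W.baseChange K).LambdaAdicSelmerData κ γ)
    (F : HeegnerFamily N W K κ jbar) (X : (W.baseChange K).SelmerDualData κ γ) : Prop :=
  (Module.Finite (IwasawaAlgebra p) D.S ∧ NoZeroSMulDivisors (IwasawaAlgebra p) D.S ∧
      Module.finrank (IwasawaAlgebra p) D.S = 1) ∧
    (Module.Finite (IwasawaAlgebra p) X.X ∧ Module.finrank (IwasawaAlgebra p) X.X = 1 ∧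
      Module.charIdeal (IwasawaAlgebra p) (Submodule.torsion (IwasawaAlgebra p) X.X) ∣
        heegnerCharIdeal D F ^ 2)

/-- The tree's `Howard2004_thmB` is `HowardHypotheses → HowardThmBConclusion` (definitional).
[cite: Howard2004HeegnerKolyvagin, §1 Thm. B] -/
theorem howard2004_thmB_iff :
    Howard2004_thmB N W K p κ γ jbar ↔
      ∀ (_ : HowardHypotheses N W K p κ γ) (D : (W.baseChange K).LambdaAdicSelmerData κ γ)
        (F : HeegnerFamily N W K κ jbar) (X : (W.baseChange K).SelmerDualData κ γ),
        HowardThmBConclusion p D F X :=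
  Iff.rfl

/-- **TYPED CELL STATEMENT (memo `KOLY-MEMO.md` Thm. 4.1 (B); referee pending; OPEN obligation node,
nothing asserted): Howard 2004 Theorem B with surjectivity replaced by irreducibility, `p ≥ 5`.**
Under `HowardHypothesesIrr` (in particular on every X9 pair with admissible `(K, κ, γ)`), the
conclusion of Howard's Thm. B holds: `H¹_{F_Λ}(K, 𝐓)` torsion-free of rank one, `X ∼ Λ ⊕ M ⊕ M`,
`ch(M) ∣ ch(H¹_{F_Λ}(K,𝐓)/Λκ₁^{Heeg})` in `Λ` (all height-one primes, `pΛ` included — Howard: "the case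
`𝔭 = pΛ` is dealt with in an entirely similar fashion, taking `𝔮 = T^m + p`"), recorded through the
same pseudo-isomorphism-invariant consequences as the tree's `Howard2004_thmB`. This is the shape of
the result announced as "[BS24]" in Burungale–Castella–Skinner 2025 Rem. 1.2.3 ("the only case
excluded by Theorem 1.2.2(b) is that of (residually) dihedral primes `p`. It will be treated in
[BS24]"), not posted as of 2026-08-25; the cell's proof also covers the `𝔖₄` image type. With BCS
Thm. 4.2.1 ("if (sur) holds, then both divisibilities hold integrally … part (a) follows from [How04,
Thm. B]") it yields BCS Thms. 1.2.2 (b), 1.2.4 (b), 1.4.1 (b) under the hypotheses of their parts (a)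
(memo Cor. 4.2) and `BSD_p(E/K)` in analytic rank one over `K` (memo Cor. 4.3); it does NOT yield
`IntegralMainConjectureOnClassX9` (memo Prop. 5.1). KERNEL STATUS: open; the memo is a paper proof.
[cite: Howard2004HeegnerKolyvagin, §1 Thm. B, §2.3, Lemma 2.6.2, §3.1] [cite: BurungaleCastellaSkinner2025, Rem. 1.2.3 and Thm. 4.2.1 (p. 8)] [cite: CastellaGrossiLeeSkinner2022, §3.3 (error terms C₁, C₂) and Thm. 3.4.1] -/
@[conjecture] def Howard2004_thmB_of_irreducible : Prop :=
  ∀ (_ : HowardHypothesesIrr N W K p κ γ) (D : (W.baseChange K).LambdaAdicSelmerData κ γ)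
    (F : HeegnerFamily N W K κ jbar) (X : (W.baseChange K).SelmerDualData κ γ),
    HowardThmBConclusion p D F X

variable {N W K p κ γ jbar}

/-- **Sanity edge**: the cell statement implies Howard's printed Theorem B on the locus `p ≥ 5`,
`E[p]` irreducible (where both hypothesis packages can be compared without relating the `p`-adic
image over `K` to the mod-`p` image over ℚ). [cite: Howard2004HeegnerKolyvagin, §1 Thm. B] -/
theorem Howard2004_thmB_of_howard2004_thmB_of_irreducible
    (h : Howard2004_thmB_of_irreducible N W K p κ γ jbar) (h5 : 5 ≤ p)
    (hirr : W.HasIrreducibleModPGaloisRep p) : Howard2004_thmB N W K p κ γ jbar :=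
  fun hyp D F X => h (HowardHypothesesIrr.of_howardHypotheses hyp h5 hirr) D F X

/-- **Consumer edge (class X9)**: the cell statement delivers the conclusion of Howard's Theorem B —
hence the integral anticyclotomic Kolyvagin-system divisibility — at EVERY X9 pair, for every
admissible anticyclotomic datum, although Howard's printed hypotheses are unsatisfiable there.
[cite: Howard2004HeegnerKolyvagin, §1 Thm. B] -/
theorem howardThmBConclusion_of_classX9 [W.IsElliptic]
    (h : Howard2004_thmB_of_irreducible N W K p κ γ jbar)
    (hX9 : ClassX9 W p) (hK : IsImaginaryQuadratic K)
    (hd : NumberField.discr K ≠ -3 ∧ NumberField.discr K ≠ -4) (hH : SatisfiesHeegnerHypothesis N K)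
    (hN : ¬ p ∣ N) (hD : ¬ (p : ℤ) ∣ NumberField.discr K) (hh : ¬ p ∣ NumberField.classNumber K)
    (hκ : κ.IsAnticyclotomic) (hγ : κ.IsTopGenerator γ)
    (D : (W.baseChange K).LambdaAdicSelmerData κ γ) (F : HeegnerFamily N W K κ jbar)
    (X : (W.baseChange K).SelmerDualData κ γ) : HowardThmBConclusion p D F X :=
  h (HowardHypothesesIrr.of_classX9 hX9 hK hd hH hN hD hh hκ hγ) D F X

end Howard

/-! ### 3. Appended 2026-08-25 (same seat): the Howard-side name is IN PRINT modulo a citation flag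

After v1.1 of the memo the cell's literature seat located the STATEMENT of `Howard2004_thmB_of_irreducible`
in refereed print: Burungale–Castella–Kim, ANT 15 (2021), Thm. 3.1 (proof by citation: Howard 2004 under
big image + Fouquet, Compositio 2013, Cor. 5.21 for the image relaxation) — now the tree's named fact
`BurungaleCastellaKim2021.thm31_howardThmB_of_irreducible` (flag `BCK21-3.1@How04+Fouquet13`). The
memo's Thm. 4.1 (REF-KOLY-VERDICT: PASS, v1.3) is the cell's independent verification of that statement.
So the @[conjecture] above is discharged CONDITIONALLY on the printed fact (a `conditional-result` in the
gate's sense; the name stays an obligation node until the fact itself is proved in the kernel). -/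

section InPrint

variable (N : ℕ) [NeZero N] (W : WeierstrassCurve ℚ) [W.IsElliptic] [W.IsGloballyMinimal]
  (K : Type u) [Field K] [NumberField K] (p : ℕ) [Fact p.Prime] (κ : ZpExtension K p)
  (γ : absoluteGaloisGroup K) (jbar : AlgebraicClosure K →+* ℂ)

/-- **`Howard2004_thmB_of_irreducible` from the printed Burungale–Castella–Kim 2021 Thm. 3.1** (named
fact `BurungaleCastellaKim2021.thm31_howardThmB_of_irreducible`, whose hypotheses are exactly the fields
of `HowardHypothesesIrr`): the cell statement of memo Thm. 4.1 (B) holds conditionally on that PUB fact.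
[cite: BurungaleCastellaKim2021, Thm. 3.1 (ii)–(iv)] -/
theorem howard2004_thmB_of_irreducible_of_bck21
    (h : BurungaleCastellaKim2021.thm31_howardThmB_of_irreducible.{u}) :
    Howard2004_thmB_of_irreducible N W K p κ γ jbar :=
  fun hyp D F X => h N W K p κ γ jbar hyp.isImaginaryQuadratic hyp.discr_ne hyp.heegner hyp.five_le
    hyp.not_dvd_level hyp.not_dvd_discr hyp.not_dvd_classNumber hyp.irreducible hyp.ordinary
    hyp.anticyclotomic hyp.topGenerator D F X

variable {N W K p κ γ jbar} in
/-- **At every X9 pair, Howard's Theorem B conclusion holds conditionally on BCK21 Thm. 3.1** (the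
printed fact) — the integral anticyclotomic Kolyvagin-system divisibility that BCS 2025 Thm. 4.2.1
records only under (sur). [cite: BurungaleCastellaKim2021, Thm. 3.1 (ii)–(iv)] -/
theorem howardThmBConclusion_of_classX9_of_bck21
    (h : BurungaleCastellaKim2021.thm31_howardThmB_of_irreducible.{u})
    (hX9 : ClassX9 W p) (hK : IsImaginaryQuadratic K)
    (hd : NumberField.discr K ≠ -3 ∧ NumberField.discr K ≠ -4) (hH : SatisfiesHeegnerHypothesis N K)
    (hN : ¬ p ∣ N) (hD : ¬ (p : ℤ) ∣ NumberField.discr K) (hh : ¬ p ∣ NumberField.classNumber K)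
    (hκ : κ.IsAnticyclotomic) (hγ : κ.IsTopGenerator γ)
    (D : (W.baseChange K).LambdaAdicSelmerData κ γ) (F : HeegnerFamily N W K κ jbar)
    (X : (W.baseChange K).SelmerDualData κ γ) : HowardThmBConclusion p D F X :=
  howardThmBConclusion_of_classX9 (howard2004_thmB_of_irreducible_of_bck21 N W K p κ γ jbar h)
    hX9 hK hd hH hN hD hh hκ hγ D F X

end InPrint

end Summit.BirchSwinnertonDyer.BirchSwinnertonDyer.Rank1Residual
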